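import Summits.ValiantsHypothesis.ValiantsHypothesis.Theses.ChowBorderDepth3
import Summits.ValiantsHypothesis.ValiantsHypothesis.Theorems.ChowBorderDepth3Depth3ChasmPaddedChasm
import Summits.ValiantsHypothesis.ValiantsHypothesis.Theorems.ChowBorderDepth3Depth3ChasmChasmExponent

/-!
# Crux `Depth3Chasm` (item stmt-ValiantsHypothesis-5935) of route `ChowBorderDepth3`
# (shared with route `SummationBits`): the depth-three chasm for VP families — PROVED

**Claim settled** (`Summit.ValiantsHypothesis.ValiantsHypothesis.Theses.ChowBorderDepth3.Depth3Chasm`):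
every VP family `f` over `ℂ` (on arbitrary finite variable types `σ n`) has, for some `c` and all
`n`, an arithmetic circuit of product-depth `≤ 1` (a `ΣΠΣ` circuit) computing `f n` with at most
`(n + 2) ^ (c ⌊√(deg f_n)⌋ + c)` wires — the chasm at depth three of
Gupta–Kamath–Kayal–Saptharishi (SIAM J. Comput. 45 (2016), Thm. 1.1) in Tavenas' sharpened form
(Inform. Comput. 240 (2015), Cor. 1: `ΣΠΣ` size `2^{O(√(d log N log s))}`), in the tree's
wire-counted unbounded-fan-in model.

**Proof** (line `registered` = `Cruxes/Depth3Chasm/Lines/birth.lean`, two registered stubs, both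
landed under `Theorems/ChowBorderDepth3Depth3Chasm*.lean`):
* `stub_paddedChasm` — the chasm with a FREE size parameter `m` dominating degree and number of
  variables, over an arbitrary finite variable type (from the discharged `Fin n`-form
  `Literature.Computability.AlgebraicComplexity.sigmaPiSigma_edgeSize_le_of_complexity_holds` by
  padding the variables and renaming the circuit back);
* `stub_chasmExponent` — the p-bounded exponent arithmetic
  `2^(K⌊√(d (log₂ m + 1)(log₂ s + 1))⌋ + K) ≤ (m+2)^(c⌊√d⌋ + c)` for `d, s ≤ m^a + a`;
* `depth3Chasm_proof` — the composition: unpack `IsVPFamily f` into ONE exponent `a` bounding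
  `#σ n + deg f_n + L(f_n)` (`IsPBounded.add_holds`), take `K := K(a)` and `c := c(a, K)`, and
  chain the two bounds at `m := n`, `d := deg f_n`, `s := L(f_n)`.

Unconditional (axioms `propext`, `Classical.choice`, `Quot.sound`).  References: A. Gupta,
P. Kamath, N. Kayal, R. Saptharishi, *Arithmetic circuits: a chasm at depth three*, SIAM J.
Comput. 45(3) (2016) 1064–1079, Thm. 1.1, §3 (size = wires); S. Tavenas, *Improved bounds for
reduction to depth 4 and depth 3*, Inform. and Comput. 240 (2015) 2–11, Cor. 1; P. Bürgisser,
*Completeness and Reduction in Algebraic Complexity Theory* (2000), Def. 2.1–2.4 (p-bounded, VP).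
-/

-- layout Summits/ValiantsHypothesis/ValiantsHypothesis forces the duplicated namespace component
set_option linter.dupNamespace false

noncomputable section

namespace Summit.ValiantsHypothesis.ValiantsHypothesis.Theorems.ChowBorderDepth3Depth3Chasm

open Literature.Computability.AlgebraicComplexity

/-- **The crux `Depth3Chasm`** (depth-three chasm for VP families over `ℂ`, GKKS 2016 Thm. 1.1 via
Tavenas 2015 Cor. 1, in the tree's wire-counted product-depth model): every VP family `f` has,
for some `c` and all `n`, a product-depth-`≤ 1` circuit computing `f n` with at most
`(n + 2) ^ (c ⌊√(deg f_n)⌋ + c)` wires.  The composition of the line: unpack `IsVPFamily f`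
(`#σ n`, `deg f_n`, `L(f_n)` p-bounded) into a single exponent `a` via `IsPBounded.add_holds`,
take `K := K(a)` from the landed stub `stub_paddedChasm` and `c := c(a, K)` from the landed stub
`stub_chasmExponent`, and chain the two bounds at `m := n`, `d := deg f_n`, `s := L(f_n)`.
[cite: GuptaKamathKayalSaptharishi2016, Thm. 1.1] [cite: Tavenas2015, Cor. 1] -/
theorem depth3Chasm_proof :
    Summit.ValiantsHypothesis.ValiantsHypothesis.Theses.ChowBorderDepth3.Depth3Chasm := by
  intro σ _ f hf
  -- `IsVPFamily f = (IsPBounded #σ ∧ IsPBounded deg) ∧ IsPBounded L`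
  obtain ⟨⟨hcard, hdeg⟩, hcomp⟩ := hf
  -- one exponent for all three p-bounded quantities
  obtain ⟨a, ha⟩ := IsPBounded.add_holds (IsPBounded.add_holds hcard hdeg) hcomp
  -- the padded chasm (stub 1) and the exponent arithmetic (stub 2) at this exponent
  obtain ⟨K, hK⟩ := stub_paddedChasm a
  obtain ⟨c, hc⟩ := stub_chasmExponent a K
  refine ⟨c, fun n => ?_⟩
  have hn : Fintype.card (σ n) + (f n).totalDegree + complexity (f n) ≤ n ^ a + a := ha n
  have hcard' : Fintype.card (σ n) ≤ n ^ a + a :=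
    le_trans (le_trans (Nat.le_add_right _ _) (Nat.le_add_right _ _)) hn
  have hdeg' : (f n).totalDegree ≤ n ^ a + a :=
    le_trans (le_trans (Nat.le_add_left _ _) (Nat.le_add_right _ _)) hn
  have hcomp' : complexity (f n) ≤ n ^ a + a := le_trans (Nat.le_add_left _ _) hn
  obtain ⟨P, hP, hpd, hE⟩ :=
    hK n (complexity (f n)) (f n).totalDegree (f n) le_rfl hdeg' hcard' le_rfl
  exact ⟨P, hP, hpd, hE.trans (hc n (f n).totalDegree (complexity (f n)) hdeg' hcomp')⟩

end Summit.ValiantsHypothesis.ValiantsHypothesis.Theorems.ChowBorderDepth3Depth3Chasm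

end
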